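import Summits.HodgeConjecture.HodgeConjecture.Theorems.LinearSystemTorelliLocalTubeSpanPairMoves
import Summits.HodgeConjecture.HodgeConjecture.Theorems.LinearSystemTorelliLocalTubeSpanTransvectionIdentities
import Mathlib.Tactic.Module

/-!
# Route LinearSystemTorelli — crux `LocalTubeSpan` (stmt-HodgeConjecture-2490): the transvection along `a - b` for an odd β-pair of partners is monodromy

Helper file (`--supports stmt-HodgeConjecture-2490`, line `Sketch` of the crux chain, cycle 9
wave 2, continuation lead c7; the lead's stub `stub_betaPairOdd`, worker W4).  Cycle 9 discharges
Janssen's Theorem 2.5 (`Γ_Δ ⊇ Sp♯₂(ℤΔ)`, [Janssen1983] Thm. 2.5 = [Schnell2010] §7 Thm. 10) for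
lattices that are unimodular modulo their radical; this file supplies transvections along
NON-unimodular, non-vanishing lattice vectors.

Setting: an alternating form `B` on a `ℚ`-space `V`, a skew vanishing lattice `Δ`
(`IsSkewVanishingLattice`, monodromy group `Γ_Δ = transvectionGroup B Δ` generated by the
transvections `T_δ v = v - B(v, δ) δ`, `δ ∈ Δ`), a vanishing cycle `u ∈ Δ` and two PARTNERS
`a, b ∈ Δ` of `u` (`B(u, a) = B(u, b) = 1`) with `B(a, b) = β ∈ ℤ`.  MAIN THEOREM
`localTubeSpan_betaPairOdd`: if `β` is ODD, some element of `Γ_Δ` acts as the transvection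
`T_{a-b} : v ↦ v - B(v, a - b) (a - b)`.

Proof (Heisenberg calculus along the radical vector of the rank-3 lattice `⟨u, a, b⟩`).  Put
`r := a - b - β u` (`r ⟂ u, a, b`) and `v₀ := a - β u` (so `b = v₀ - r`, `a - b = r + β u`,
`B(u, v₀) = 1`, `B(a, v₀) = β`).  For `c ⟂ r` and `k ∈ ℚ` write
`h_{c,k} x := x + B(x, c) r + B(x, r) c + k B(x, r) r`; these compose by the Heisenberg law
`h_{c,k} ∘ h_{c',k'} = h_{c+c', k+k'+B(c',c)}` (`localTubeSpan_heisenberg_comp`), and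
conjugating by an isometry `σ` fixing `r` gives `σ h_{c,k} σ⁻¹ = h_{σc,k}`
(`localTubeSpan_betaPairOdd_heis_conj`).
* `v₀ = T_u^{-β} a ∈ Δ` (integral shears along `u` are monodromy, stability of `Δ`), and
  `h := T_b T_{v₀}⁻¹ ∈ Γ_Δ` acts as `h_{v₀,-1}` (`localTubeSpan_betaPairOdd_tb_tvinv`).
* The elements `s₁ := z T_u^{β}`, `s₂ := T_a T_u^{β+1}`, `s₃ := z s₂` of `Γ_Δ`, where
  `z = T_u² T_a² T_{u+a}²` is the `-1` of the plane `(u, a)`, fix `r` and map `v₀` to `-a`, `u`,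
  `-u`; so `s₁ h s₁⁻¹`, `s₂ h s₂⁻¹`, `s₃ h s₃⁻¹` act as `h_{-a,-1}`, `h_{u,-1}`, `h_{-u,-1}`.
* `sq := (s₂ h s₂⁻¹)(s₃ h s₃⁻¹)` acts as `h_{0,-2} : x ↦ x - 2 B(x, r) r`, whose integer powers
  give every `x ↦ x + 2m B(x, r) r` (`localTubeSpan_betaPairOdd_radial_zsmul`); `β` odd makes
  `1 + β = 2m`.
* `h (s₁ h s₁⁻¹)` acts as `h_{v₀-a, -2+B(-a,v₀)} = h_{-βu, -2-β}`; following it by `h_{0,1+β}`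
  gives `h_{-βu,-1}`, and `T_u^{β²} ∘ h_{-βu,-1} = T_{r+βu} = T_{a-b}`
  (`localTubeSpan_betaPairOdd_assemble`).

References: [Janssen1983] W. A. M. Janssen, *Skew-symmetric vanishing lattices and their monodromy
groups*, Math. Ann. 266 (1983), Thm. 2.5; [Schnell2010] C. Schnell, *Primitive cohomology and the
tube mapping*, Math. Z. 268 (2010) §7.  No named facts; no `sorry`.
-/

-- `Summit.HodgeConjecture.HodgeConjecture.Theorems` is the mandated namespace (single-conjunct summit:
-- Sub = Summit), which `linter.dupNamespace` flags on every declaration; the lakefile turns the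
-- linter off tree-wide (weak option), restated here so stand-alone elaboration is warning-free too.
set_option linter.dupNamespace false

noncomputable section

open Literature.AlgebraicGeometry.HodgeTheory

namespace Summit.HodgeConjecture.HodgeConjecture.Theorems

variable {V : Type} [AddCommGroup V] [Module ℚ V]

/-! ### Heisenberg calculus along a vector `r` -/

section Heisenberg

/-- **Realised Heisenberg elements compose.**  For an alternating form `B`, vectors `c, c' ⟂ r` and
units `g, g'` of `End V` acting as `h_{c,k}` and `h_{c',k'}`
(`h_{c,k} x = x + B(x, c) r + B(x, r) c + k B(x, r) r`), the product `g g'` acts as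
`h_{c+c', k+k'+B(c',c)}` (the Heisenberg composition law `localTubeSpan_heisenberg_comp`).
[folklore] -/
theorem localTubeSpan_betaPairOdd_heis_mul (B : LinearMap.BilinForm ℚ V) (hB : B.IsAlt)
    {r c c' : V} (k k' : ℚ) (hcr : B c r = 0) (hc'r : B c' r = 0) {g g' : (V →ₗ[ℚ] V)ˣ}
    (hg : ∀ x : V, (g : V →ₗ[ℚ] V) x = x + B x c • r + B x r • c + k • (B x r • r))
    (hg' : ∀ x : V, (g' : V →ₗ[ℚ] V) x = x + B x c' • r + B x r • c' + k' • (B x r • r)) (x : V) :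
    ((g * g' : (V →ₗ[ℚ] V)ˣ) : V →ₗ[ℚ] V) x =
      x + B x (c + c') • r + B x r • (c + c') + (k + k' + B c' c) • (B x r • r) := by
  rw [Units.val_mul, Module.End.mul_apply, hg', hg]
  exact localTubeSpan_heisenberg_comp B hB k k' hcr hc'r x

/-- **Conjugating a Heisenberg element by an isometry fixing `r`.**  If the unit `σ` of `End V` is
an isometry of `B` with `σ r = r` and the unit `g` acts as `h_{c,k}`
(`h_{c,k} x = x + B(x, c) r + B(x, r) c + k B(x, r) r`), then `σ g σ⁻¹` acts as `h_{σc,k}`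
(`B(σ⁻¹ x, c) = B(x, σ c)` and `B(σ⁻¹ x, r) = B(x, σ r) = B(x, r)`). [folklore] -/
theorem localTubeSpan_betaPairOdd_heis_conj (B : LinearMap.BilinForm ℚ V) {r c : V} (k : ℚ)
    {σ g : (V →ₗ[ℚ] V)ˣ}
    (hiso : ∀ x y : V, B ((σ : V →ₗ[ℚ] V) x) ((σ : V →ₗ[ℚ] V) y) = B x y)
    (hσr : (σ : V →ₗ[ℚ] V) r = r)
    (hg : ∀ x : V, (g : V →ₗ[ℚ] V) x = x + B x c • r + B x r • c + k • (B x r • r)) (x : V) :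
    ((σ * g * σ⁻¹ : (V →ₗ[ℚ] V)ˣ) : V →ₗ[ℚ] V) x =
      x + B x ((σ : V →ₗ[ℚ] V) c) • r + B x r • (σ : V →ₗ[ℚ] V) c + k • (B x r • r) := by
  have h1 : B (((σ⁻¹ : (V →ₗ[ℚ] V)ˣ) : V →ₗ[ℚ] V) x) c = B x ((σ : V →ₗ[ℚ] V) c) := by
    rw [← hiso (((σ⁻¹ : (V →ₗ[ℚ] V)ˣ) : V →ₗ[ℚ] V) x) c, localTubeSpan_units_apply_inv_apply]
  have h2 : B (((σ⁻¹ : (V →ₗ[ℚ] V)ˣ) : V →ₗ[ℚ] V) x) r = B x r := by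
    rw [← hiso (((σ⁻¹ : (V →ₗ[ℚ] V)ˣ) : V →ₗ[ℚ] V) x) r, localTubeSpan_units_apply_inv_apply, hσr]
  rw [Units.val_mul, Units.val_mul, Module.End.mul_apply, Module.End.mul_apply, hg]
  simp only [map_add, map_smul, hσr, localTubeSpan_units_apply_inv_apply, h1, h2]

/-- **Integer powers of a realised radial shear.**  If an element `g ∈ Γ_Δ` acts as
`x ↦ x + c B(x, r) r` (for an alternating `B`, so `B(r, r) = 0` and `g⁻¹` acts as
`x ↦ x - c B(x, r) r`), then for every `m ∈ ℤ` some element of `Γ_Δ` (the power `gᵐ`) acts as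
`x ↦ x + m c B(x, r) r`. [folklore] -/
theorem localTubeSpan_betaPairOdd_radial_zsmul (B : LinearMap.BilinForm ℚ V) (hB : B.IsAlt)
    (Δ : Set V) {r : V} (c : ℚ) {g : (V →ₗ[ℚ] V)ˣ} (hgΓ : g ∈ transvectionGroup B Δ)
    (hg : ∀ x : V, (g : V →ₗ[ℚ] V) x = x + c • (B x r • r)) (m : ℤ) :
    ∃ g' ∈ transvectionGroup B Δ, ∀ x : V,
      ((g' : (V →ₗ[ℚ] V)ˣ) : V →ₗ[ℚ] V) x = x + ((m : ℚ) * c) • (B x r • r) := by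
  have hrr : B r r = 0 := hB.self_eq_zero r
  have hginv : ∀ x : V, ((g⁻¹ : (V →ₗ[ℚ] V)ˣ) : V →ₗ[ℚ] V) x = x - c • (B x r • r) := fun x => by
    have h1 : (g : V →ₗ[ℚ] V) (x - c • (B x r • r)) = x := by
      rw [hg]
      simp only [map_sub, map_smul, LinearMap.sub_apply, LinearMap.smul_apply, smul_eq_mul, hrr]
      module
    calc ((g⁻¹ : (V →ₗ[ℚ] V)ˣ) : V →ₗ[ℚ] V) x
        = ((g⁻¹ : (V →ₗ[ℚ] V)ˣ) : V →ₗ[ℚ] V) ((g : V →ₗ[ℚ] V) (x - c • (B x r • r))) := by rw [h1]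
      _ = x - c • (B x r • r) := localTubeSpan_units_inv_apply_apply g _
  induction m using Int.induction_on with
  | zero =>
    exact ⟨1, one_mem _, fun x => by
      rw [Units.val_one, Module.End.one_apply, Int.cast_zero, zero_mul, zero_smul, add_zero]⟩
  | succ i ih =>
    obtain ⟨g', hg'Γ, hg'x⟩ := ih
    refine ⟨g * g', mul_mem hgΓ hg'Γ, fun x => ?_⟩
    rw [Units.val_mul, Module.End.mul_apply, hg'x, hg]
    simp only [map_add, map_smul, LinearMap.add_apply, LinearMap.smul_apply, smul_eq_mul, hrr]
    push_cast
    module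
  | pred i ih =>
    obtain ⟨g', hg'Γ, hg'x⟩ := ih
    refine ⟨g⁻¹ * g', mul_mem (inv_mem hgΓ) hg'Γ, fun x => ?_⟩
    rw [Units.val_mul, Module.End.mul_apply, hg'x, hginv]
    simp only [map_add, map_smul, LinearMap.add_apply, LinearMap.smul_apply, smul_eq_mul, hrr]
    push_cast
    module

/-- **Identity (I): `T_{v₀-r} T_{v₀}⁻¹ = h_{v₀,-1}`.**  For an alternating form `B` and `v₀ ⟂ r`,
`T_{v₀-r} (x + B(x, v₀) v₀) = x + B(x, v₀) r + B(x, r) v₀ - B(x, r) r`. [folklore] -/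
theorem localTubeSpan_betaPairOdd_tb_tvinv (B : LinearMap.BilinForm ℚ V) (hB : B.IsAlt) {v₀ r : V}
    (hv₀r : B v₀ r = 0) (x : V) :
    skewTransvection B (v₀ - r) (x + B x v₀ • v₀) =
      x + B x v₀ • r + B x r • v₀ + (-1 : ℚ) • (B x r • r) := by
  simp only [skewTransvection_apply, map_add, map_sub, map_smul, hv₀r, hB.self_eq_zero]
  module

/-- **Identity (III): `T_u^{β²} ∘ h_{-βu,-1} = T_{r+βu}`.**  For an alternating form `B`, `r ⟂ u`
and `β ∈ ℚ`, applying the shear `y ↦ y - β² B(y, u) u` after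
`h_{-βu,-1} : x ↦ x + B(x, -βu) r + B(x, r) (-βu) - B(x, r) r` gives the transvection along
`r + β u`. [folklore] -/
theorem localTubeSpan_betaPairOdd_assemble (B : LinearMap.BilinForm ℚ V) (hB : B.IsAlt) {u r : V}
    (hru : B r u = 0) (β : ℚ) (x : V) :
    (x + B x (-(β • u)) • r + B x r • (-(β • u)) + (-1 : ℚ) • (B x r • r)) +
        (-(β ^ 2)) •
          (B (x + B x (-(β • u)) • r + B x r • (-(β • u)) + (-1 : ℚ) • (B x r • r)) u • u) =
      x - B x (r + β • u) • (r + β • u) := by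
  simp only [map_add, map_neg, map_smul, LinearMap.add_apply, LinearMap.neg_apply,
    LinearMap.smul_apply, smul_eq_mul, hru, hB.self_eq_zero]
  module

end Heisenberg

/-! ### The odd β-pair transvection -/

/-- **The odd β-pair transvection is monodromy** (cycle 9, stub `stub_betaPairOdd`; a case of
Janssen's Theorem 2.5 proved directly).  For a skew vanishing lattice `Δ` with alternating form `B`,
a vanishing cycle `u ∈ Δ`, two partners `a, b ∈ Δ` of `u` (`B(u, a) = B(u, b) = 1`) and
`B(a, b) = β` ODD, some element of `Γ_Δ` acts as the transvection
`T_{a-b} : v ↦ v - B(v, a-b) (a-b)` along the (non-unimodular, in general non-vanishing) lattice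
vector `a - b`.  (Heisenberg calculus along the radical vector `r = a - b - β u` of `⟨u, a, b⟩`:
with `v₀ = a - β u ∈ Δ` and `h = T_b T_{v₀}⁻¹ = h_{v₀,-1}`, the word
`T_u^{β²} · h · (s₁ h s₁⁻¹) · h_{0,1+β}` acts as `T_{a-b}`, where `s₁ = z T_u^β`,
`z = T_u² T_a² T_{u+a}²`, and `h_{0,1+β}` is the `-(1+β)/2`-th power of
`(s₂ h s₂⁻¹)(s₃ h s₃⁻¹) = h_{0,-2}`, `s₂ = T_a T_u^{β+1}`, `s₃ = z s₂`; see the module docstring.)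
[cite: Janssen1983, Thm. 2.5] -/
theorem localTubeSpan_betaPairOdd (B : LinearMap.BilinForm ℚ V) (hB : B.IsAlt) (Δ : Set V)
    (hΔ : IsSkewVanishingLattice B Δ) {u a b : V} (hu : u ∈ Δ) (ha : a ∈ Δ) (hb : b ∈ Δ)
    (hua : B u a = 1) (hub : B u b = 1) {β : ℤ} (hab : B a b = β) (hβ : Odd β) :
    ∃ g ∈ transvectionGroup B Δ, ∀ v : V,
      ((g : (V →ₗ[ℚ] V)ˣ) : V →ₗ[ℚ] V) v = v - B v (a - b) • (a - b) := by
  obtain ⟨j, hj⟩ := hβ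
  have hau : B a u = -1 := by rw [← hB.neg_eq, hua]
  -- the radical vector `r` of `⟨u, a, b⟩` and the vanishing cycle `v₀ = a - β u`
  obtain ⟨r, hr⟩ : ∃ r : V, r = a - b - (β : ℚ) • u := ⟨_, rfl⟩
  obtain ⟨v₀, hv₀⟩ : ∃ v₀ : V, v₀ = a - (β : ℚ) • u := ⟨_, rfl⟩
  have hbvr : b = v₀ - r := by rw [hv₀, hr]; module
  have habr : a - b = r + (β : ℚ) • u := by rw [hr]; module
  have hv₀a : v₀ + -a = -((β : ℚ) • u) := by rw [hv₀]; module
  -- the pairing table of `u, a, v₀, r`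
  have hur : B u r = 0 := by rw [hr]; simp [hua, hub, hB.self_eq_zero]
  have hru : B r u = 0 := by rw [← hB.neg_eq, hur, neg_zero]
  have har : B a r = 0 := by
    rw [hr]; simp only [map_sub, map_smul, smul_eq_mul, hab, hau, hB.self_eq_zero]; ring
  have hra : B r a = 0 := by rw [← hB.neg_eq, har, neg_zero]
  have hv₀r : B v₀ r = 0 := by
    rw [hv₀, hr]
    simp only [map_sub, map_smul, LinearMap.sub_apply, LinearMap.smul_apply, smul_eq_mul, hab, hau,
      hua, hub, hB.self_eq_zero]
    ring
  have hnar : B (-a) r = 0 := by rw [map_neg, LinearMap.neg_apply, har, neg_zero]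
  have hnur : B (-u) r = 0 := by rw [map_neg, LinearMap.neg_apply, hur, neg_zero]
  have hv₀u : B v₀ u = -1 := by
    rw [hv₀]
    simp only [map_sub, map_smul, LinearMap.sub_apply, LinearMap.smul_apply, smul_eq_mul, hau,
      hB.self_eq_zero]
    ring
  have hav₀ : B a v₀ = (β : ℚ) := by
    rw [hv₀]; simp only [map_sub, map_smul, smul_eq_mul, hau, hB.self_eq_zero]; ring
  have hnav₀ : B (-a) v₀ = -(β : ℚ) := by rw [map_neg, LinearMap.neg_apply, hav₀]
  -- `v₀ = T_u^{-β} a ∈ Δ` (integral shears along `u` are monodromy; stability of `Δ`)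
  obtain ⟨sh₀, hsh₀Γ, hsh₀⟩ := localTubeSpan_pairMoves_shear_mem B hB Δ hu β
  have hv₀Δ : v₀ ∈ Δ := by
    have e : (sh₀ : V →ₗ[ℚ] V) a = v₀ := by rw [hsh₀, hau, hv₀]; module
    rw [← e]
    exact hΔ.stable _ hsh₀Γ _ ha
  -- the transvections `T_b`, `T_{v₀}`, `T_a`, and `h := T_b T_{v₀}⁻¹ = h_{v₀,-1}`
  obtain ⟨tb, htbΓ, htb⟩ := localTubeSpan_pairMoves_unit_mem B hB Δ hb
  obtain ⟨tv, htvΓ, htv⟩ := localTubeSpan_pairMoves_unit_mem B hB Δ hv₀Δ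
  obtain ⟨ta, htaΓ, hta⟩ := localTubeSpan_pairMoves_unit_mem B hB Δ ha
  have hhΓ : tb * tv⁻¹ ∈ transvectionGroup B Δ := mul_mem htbΓ (inv_mem htvΓ)
  have hh : ∀ x : V, ((tb * tv⁻¹ : (V →ₗ[ℚ] V)ˣ) : V →ₗ[ℚ] V) x =
      x + B x v₀ • r + B x r • v₀ + (-1 : ℚ) • (B x r • r) := fun x => by
    rw [Units.val_mul, Module.End.mul_apply,
      localTubeSpan_unit_inv_apply B htv (hB.self_eq_zero v₀), htb, hbvr]
    exact localTubeSpan_betaPairOdd_tb_tvinv B hB hv₀r x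
  -- the conjugators `s₁ = z T_u^β`, `s₂ = T_a T_u^{β+1}`, `s₃ = z s₂` (`z = T_u² T_a² T_{u+a}²`),
  -- all fixing `r`, with `s₁ v₀ = -a`, `s₂ v₀ = u`, `s₃ v₀ = -u`
  obtain ⟨z, hzΓ, hz⟩ := localTubeSpan_pairMoves_negOnPlane_mem B hB Δ hΔ hu ha hua
  obtain ⟨sh₁, hsh₁Γ, hsh₁⟩ := localTubeSpan_pairMoves_shear_mem B hB Δ hu (-β)
  obtain ⟨sh₂, hsh₂Γ, hsh₂⟩ := localTubeSpan_pairMoves_shear_mem B hB Δ hu (-(β + 1))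
  have hs₁Γ : z * sh₁ ∈ transvectionGroup B Δ := mul_mem hzΓ hsh₁Γ
  have hs₂Γ : ta * sh₂ ∈ transvectionGroup B Δ := mul_mem htaΓ hsh₂Γ
  have hs₃Γ : z * (ta * sh₂) ∈ transvectionGroup B Δ := mul_mem hzΓ hs₂Γ
  have hzr : (z : V →ₗ[ℚ] V) r = r := by rw [hz, hra, hru]; module
  have hsh₁r : (sh₁ : V →ₗ[ℚ] V) r = r := by rw [hsh₁, hru, zero_smul, smul_zero, add_zero]
  have hsh₂r : (sh₂ : V →ₗ[ℚ] V) r = r := by rw [hsh₂, hru, zero_smul, smul_zero, add_zero]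
  have htar : (ta : V →ₗ[ℚ] V) r = r := by
    rw [hta, skewTransvection_apply, hra, zero_smul, sub_zero]
  have hs₁r : ((z * sh₁ : (V →ₗ[ℚ] V)ˣ) : V →ₗ[ℚ] V) r = r := by
    rw [Units.val_mul, Module.End.mul_apply, hsh₁r, hzr]
  have hs₂r : ((ta * sh₂ : (V →ₗ[ℚ] V)ˣ) : V →ₗ[ℚ] V) r = r := by
    rw [Units.val_mul, Module.End.mul_apply, hsh₂r, htar]
  have hs₃r : ((z * (ta * sh₂) : (V →ₗ[ℚ] V)ˣ) : V →ₗ[ℚ] V) r = r := by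
    rw [Units.val_mul, Module.End.mul_apply, hs₂r, hzr]
  have hs₁v₀ : ((z * sh₁ : (V →ₗ[ℚ] V)ˣ) : V →ₗ[ℚ] V) v₀ = -a := by
    have e : (sh₁ : V →ₗ[ℚ] V) v₀ = a := by rw [hsh₁, hv₀u, hv₀]; push_cast; module
    rw [Units.val_mul, Module.End.mul_apply, e, hz, hB.self_eq_zero, hau]
    module
  have hs₂v₀ : ((ta * sh₂ : (V →ₗ[ℚ] V)ˣ) : V →ₗ[ℚ] V) v₀ = u := by
    have e : (sh₂ : V →ₗ[ℚ] V) v₀ = a + u := by rw [hsh₂, hv₀u, hv₀]; push_cast; module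
    rw [Units.val_mul, Module.End.mul_apply, e, hta, skewTransvection_apply, map_add,
      LinearMap.add_apply, hB.self_eq_zero, hua]
    module
  have hs₃v₀ : ((z * (ta * sh₂) : (V →ₗ[ℚ] V)ˣ) : V →ₗ[ℚ] V) v₀ = -u := by
    rw [Units.val_mul, Module.End.mul_apply, hs₂v₀, hz, hB.self_eq_zero, hua]
    module
  -- the conjugates `sᵢ h sᵢ⁻¹ ∈ Γ_Δ` act as `h_{-a,-1}`, `h_{u,-1}`, `h_{-u,-1}`
  have hc₁Γ : z * sh₁ * (tb * tv⁻¹) * (z * sh₁)⁻¹ ∈ transvectionGroup B Δ :=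
    mul_mem (mul_mem hs₁Γ hhΓ) (inv_mem hs₁Γ)
  have hc₂Γ : ta * sh₂ * (tb * tv⁻¹) * (ta * sh₂)⁻¹ ∈ transvectionGroup B Δ :=
    mul_mem (mul_mem hs₂Γ hhΓ) (inv_mem hs₂Γ)
  have hc₃Γ : z * (ta * sh₂) * (tb * tv⁻¹) * (z * (ta * sh₂))⁻¹ ∈ transvectionGroup B Δ :=
    mul_mem (mul_mem hs₃Γ hhΓ) (inv_mem hs₃Γ)
  have hc₁ : ∀ x : V, ((z * sh₁ * (tb * tv⁻¹) * (z * sh₁)⁻¹ : (V →ₗ[ℚ] V)ˣ) : V →ₗ[ℚ] V) x =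
      x + B x (-a) • r + B x r • (-a) + (-1 : ℚ) • (B x r • r) := fun x => by
    rw [localTubeSpan_betaPairOdd_heis_conj B (-1)
      (localTubeSpan_transvectionGroup_isometry B hB Δ hs₁Γ) hs₁r hh x, hs₁v₀]
  have hc₂ : ∀ x : V, ((ta * sh₂ * (tb * tv⁻¹) * (ta * sh₂)⁻¹ : (V →ₗ[ℚ] V)ˣ) : V →ₗ[ℚ] V) x =
      x + B x u • r + B x r • u + (-1 : ℚ) • (B x r • r) := fun x => by
    rw [localTubeSpan_betaPairOdd_heis_conj B (-1)
      (localTubeSpan_transvectionGroup_isometry B hB Δ hs₂Γ) hs₂r hh x, hs₂v₀]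
  have hc₃ : ∀ x : V,
      ((z * (ta * sh₂) * (tb * tv⁻¹) * (z * (ta * sh₂))⁻¹ : (V →ₗ[ℚ] V)ˣ) : V →ₗ[ℚ] V) x =
        x + B x (-u) • r + B x r • (-u) + (-1 : ℚ) • (B x r • r) := fun x => by
    rw [localTubeSpan_betaPairOdd_heis_conj B (-1)
      (localTubeSpan_transvectionGroup_isometry B hB Δ hs₃Γ) hs₃r hh x, hs₃v₀]
  -- the radial square `sq := (s₂ h s₂⁻¹)(s₃ h s₃⁻¹) = h_{0,-2}` and its power `h_{0,1+β}`
  have hsq : ∀ x : V, ((ta * sh₂ * (tb * tv⁻¹) * (ta * sh₂)⁻¹ *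
      (z * (ta * sh₂) * (tb * tv⁻¹) * (z * (ta * sh₂))⁻¹) : (V →ₗ[ℚ] V)ˣ) : V →ₗ[ℚ] V) x =
        x + (-2 : ℚ) • (B x r • r) := fun x => by
    rw [localTubeSpan_betaPairOdd_heis_mul B hB (-1) (-1) hur hnur hc₂ hc₃ x]
    simp only [map_add, map_neg, LinearMap.neg_apply, hB.self_eq_zero]
    module
  obtain ⟨rad, hradΓ, hrad⟩ := localTubeSpan_betaPairOdd_radial_zsmul B hB Δ (-2)
    (mul_mem hc₂Γ hc₃Γ) hsq (-(j + 1))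
  have hcoef : (((-(j + 1) : ℤ)) : ℚ) * (-2 : ℚ) = 1 + (β : ℚ) := by rw [hj]; push_cast; ring
  -- `p := h (s₁ h s₁⁻¹)` acts as `h_{v₀-a, -2+B(-a,v₀)} = h_{-βu,-2-β}`
  have hp : ∀ x : V, ((tb * tv⁻¹ * (z * sh₁ * (tb * tv⁻¹) * (z * sh₁)⁻¹) : (V →ₗ[ℚ] V)ˣ) :
      V →ₗ[ℚ] V) x = x + B x (v₀ + -a) • r + B x r • (v₀ + -a) +
        (-1 + -1 + B (-a) v₀) • (B x r • r) :=
    localTubeSpan_betaPairOdd_heis_mul B hB (-1) (-1) hv₀r hnar hh hc₁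
  -- `q := p · h_{0,1+β}` acts as `h_{-βu,-1}`
  have hq : ∀ x : V, ((tb * tv⁻¹ * (z * sh₁ * (tb * tv⁻¹) * (z * sh₁)⁻¹) * rad : (V →ₗ[ℚ] V)ˣ) :
      V →ₗ[ℚ] V) x =
        x + B x (-((β : ℚ) • u)) • r + B x r • (-((β : ℚ) • u)) + (-1 : ℚ) • (B x r • r) :=
    fun x => by
    rw [Units.val_mul, Module.End.mul_apply, hrad, hcoef, hp, hv₀a, hnav₀]
    simp only [map_add, map_neg, map_smul, LinearMap.add_apply, LinearMap.smul_apply, smul_eq_mul,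
      hru, hB.self_eq_zero]
    module
  -- the word `T_u^{β²} · q` acts as `T_{r+βu} = T_{a-b}`
  obtain ⟨shβ, hshβΓ, hshβ⟩ := localTubeSpan_pairMoves_shear_mem B hB Δ hu (-(β ^ 2))
  have hcast : (((-(β ^ 2) : ℤ)) : ℚ) = -((β : ℚ) ^ 2) := by push_cast; ring
  refine ⟨shβ * (tb * tv⁻¹ * (z * sh₁ * (tb * tv⁻¹) * (z * sh₁)⁻¹) * rad),
    mul_mem hshβΓ (mul_mem (mul_mem hhΓ hc₁Γ) hradΓ), fun v => ?_⟩
  rw [Units.val_mul, Module.End.mul_apply, hq, hshβ, hcast, habr]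
  exact localTubeSpan_betaPairOdd_assemble B hB hru (β : ℚ) v

end Summit.HodgeConjecture.HodgeConjecture.Theorems

end
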